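import Literature.NumberTheory.EllipticCurves.PAdicDistributionPushforward
import HarnessLib

/-!
# Measures on `ℤ_p`: densities, the Möbius maps of `Σ₀(p)`, and the weight-`k` action

The coefficient modules of Pollack–Stevens / Bellaïche overconvergent modular symbols are spaces of
distributions on `ℤ_p` with the weight-`k` action of the monoid
`Σ₀(p) = {γ = (a b; c d) ∈ M₂(ℤ_p) : p ∣ c, a ∈ ℤ_p^×, ad − bc ≠ 0}`,

  `(μ |_k γ)(f) = ∫ (a + c z)^k · f((b + d z)/(a + c z)) dμ(z)`

(Bellaïche 2011, §3.1, p. 28: `γ·(1 ⊗ f) = K(a + cz)(1 ⊗ f((b + dz)/(a + cz)))`, dual action on `𝔻`;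
Pollack–Stevens 2011, §3; for ORDINARY families measures = bounded distributions suffice, as in
Greenberg–Stevens 1993, §1).  For the bounded distributions of `PAdicDistributionIntegral` on the
tower `ℤ_p = lim ℤ/p^n` this file constructs that action from two operations:

* **densities** (`BoundedDistribution.mulFn`): the bounded distribution `g·μ` with level data
  `(g·μ)_n(a) = ∫ 1_{a + p^n ℤ_p} · g dμ` for `g` uniformly continuous and bounded, with
  `∫ f d(g·μ) = ∫ f g dμ` (`integral_mulFn`);
* **the Möbius maps** `z ↦ γ·z = (b + d z)(a + c z)^{-1}` of `ℤ_p` (`moebius`; `a + c z ∈ ℤ_p^×`,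
  `autFactor`), which are `1`-Lipschitz (`norm_moebius_sub_moebius_le`), hence descend to
  level-compatible cell maps of `ℤ/p^n` (`ProfiniteTower.moebiusCellMap`) lying under `moebius`
  (`proj_moebius`), so that `PAdicDistributionPushforward.integral_map` applies;

and defines **the weight-`k` action** `μ |_k γ := (moebius γ)_* ((a + c z)^k · μ)`
(`BoundedDistribution.weightAct`) with its integration formula
`∫ f d(μ |_k γ) = ∫ (a + c z)^k f(γ·z) dμ(z)` (`integral_weightAct`).  The action law and the
equivariance of the moment map to `Symᵏ` are left to the sequel.

Brick B3a of the bottom-up plan recorded with the named fact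
`greenbergStevens_kitagawa_twoVariable_interpolation_allBranches` (B3 follows Bellaïche 2011 §3–4).
Everything is proved; no named facts.

## References

* J. Bellaïche, *Critical `p`-adic `L`-functions*, Invent. Math. 189 (2012), §3.1–3.2
  (arXiv:0912.2925). [Bellaiche2011]
* R. Pollack, G. Stevens, *Overconvergent modular symbols and `p`-adic `L`-functions*, Ann. Sci. ÉNS
  44 (2011), §3. [PollackStevens2011]
* R. Greenberg, G. Stevens, Invent. Math. 111 (1993), §1. [GreenbergStevens1993]
-/

noncomputable section

open Filter Topology

namespace Literature.NumberTheory.EllipticCurves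

variable {p : ℕ} [Fact p.Prime]

/-! ### Functions factoring through `ℤ/p^n` and cell indicators -/

section Cells

/-- Points of `ℤ_p` at distance `≤ p^{-n}` have the same residue modulo `p^n`. [folklore] -/
theorem toZModPow_eq_of_norm_sub_le {n : ℕ} {x y : ℤ_[p]} (h : ‖x - y‖ ≤ (p : ℝ) ^ (-(n : ℤ))) :
    PadicInt.toZModPow n x = PadicInt.toZModPow n y := by
  rw [PadicInt.norm_le_pow_iff_mem_span_pow, ← PadicInt.ker_toZModPow, RingHom.mem_ker, map_sub,
    sub_eq_zero] at h
  exact h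

/-- **A function factoring through `ℤ/p^n` is uniformly continuous** on `ℤ_p`. [folklore] -/
theorem uniformContinuous_comp_toZModPow {β : Type*} [PseudoMetricSpace β] (n : ℕ) (g : ZMod (p ^ n) → β) :
    UniformContinuous fun x : ℤ_[p] => g (PadicInt.toZModPow n x) := by
  refine Metric.uniformContinuous_iff.mpr fun ε hε =>
    ⟨(p : ℝ) ^ (-(n : ℤ)), zpow_pos (by exact_mod_cast (Fact.out : p.Prime).pos) _, ?_⟩
  intro x y hxy
  rw [dist_eq_norm] at hxy
  rw [toZModPow_eq_of_norm_sub_le hxy.le, dist_self]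
  exact hε

variable {𝕜 : Type*} [NormedField 𝕜]

/-- The **indicator of the cell `a + p^n ℤ_p`** as a `𝕜`-valued function. [folklore] -/
def cellInd (n : ℕ) (a : ZMod (p ^ n)) (x : ℤ_[p]) : 𝕜 := if PadicInt.toZModPow n x = a then 1 else 0

/-- Unfolding lemma for `cellInd`. [folklore] -/
theorem cellInd_apply (n : ℕ) (a : ZMod (p ^ n)) (x : ℤ_[p]) :
    cellInd (𝕜 := 𝕜) n a x = if PadicInt.toZModPow n x = a then 1 else 0 := rfl

/-- Cell indicators are uniformly continuous. [folklore] -/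
theorem uniformContinuous_cellInd (n : ℕ) (a : ZMod (p ^ n)) : UniformContinuous (cellInd (𝕜 := 𝕜) n a) :=
  uniformContinuous_comp_toZModPow n fun b => if b = a then (1 : 𝕜) else 0

/-- Cell indicators have norm `≤ 1`. [folklore] -/
theorem norm_cellInd_le (n : ℕ) (a : ZMod (p ^ n)) (x : ℤ_[p]) : ‖cellInd (𝕜 := 𝕜) n a x‖ ≤ 1 := by
  rw [cellInd_apply]; split_ifs <;> simp

/-- **A cell is the disjoint union of the cells above it**:
`Σ_{b ↦ a} 1_{b + p^{n+1}} = 1_{a + p^n}`. [folklore] -/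
theorem sum_cellInd_succ (n : ℕ) (a : ZMod (p ^ n)) (x : ℤ_[p]) :
    ∑ b ∈ Finset.univ.filter (fun b : ZMod (p ^ (n + 1)) =>
        ZMod.castHom (pow_dvd_pow p n.le_succ) (ZMod (p ^ n)) b = a), cellInd (𝕜 := 𝕜) (n + 1) b x =
      cellInd n a x := by
  classical
  simp only [cellInd_apply]
  rw [Finset.sum_ite_eq]
  -- the cell of `x` at level `n + 1` lies above `a` iff `x` lies in `a`
  simp only [Finset.mem_filter, Finset.mem_univ, true_and, ZMod.castHom_apply,
    PadicInt.cast_toZModPow _ _ n.le_succ]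

/-- `Σ_a c_a 1_a(x) = c_{x mod p^n}`: a step function is its value on the cell of `x`. [folklore] -/
theorem sum_mul_cellInd (n : ℕ) (c : ZMod (p ^ n) → 𝕜) (x : ℤ_[p]) :
    ∑ a : ZMod (p ^ n), c a * cellInd (𝕜 := 𝕜) n a x = c (PadicInt.toZModPow n x) := by
  classical
  simp only [cellInd_apply, mul_ite, mul_one, mul_zero]
  rw [Finset.sum_ite_eq]
  simp

end Cells

/-! ### Densities: the bounded distribution `g · μ` -/

namespace BoundedDistribution

variable {𝕜 : Type*} [NormedField 𝕜]

/-- Products of uniformly continuous `𝕜`-valued functions on `ℤ_p` are uniformly continuous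
(`ℤ_p` is compact). [folklore] -/
theorem uniformContinuous_mul' {f g : ℤ_[p] → 𝕜} (hf : UniformContinuous f) (hg : UniformContinuous g) :
    UniformContinuous fun x => f x * g x :=
  CompactSpace.uniformContinuous_of_continuous (hf.continuous.mul hg.continuous)

variable [IsUltrametricDist 𝕜] [CompleteSpace 𝕜] (D : BoundedDistribution (ProfiniteTower.padicInt p) 𝕜)

/-- **The density `g · μ`**: the bounded distribution with level data `(g·μ)_n(a) = ∫ 1_{a+p^n} g dμ`,
for `g` uniformly continuous with `‖g‖ ≤ C` (bound `‖μ‖ · C`). [folklore] -/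
def mulFn (g : ℤ_[p] → 𝕜) (hg : UniformContinuous g) {C : ℝ} (hC0 : 0 ≤ C) (hC : ∀ x, ‖g x‖ ≤ C) :
    BoundedDistribution (ProfiniteTower.padicInt p) 𝕜 where
  μ n a := D.integral fun x => cellInd n a x * g x
  sum_fiber n a := by
    have huc : ∀ b : ZMod (p ^ (n + 1)), UniformContinuous fun x => cellInd (𝕜 := 𝕜) (n + 1) b x * g x :=
      fun b => uniformContinuous_mul' (uniformContinuous_cellInd _ _) hg
    change ∑ b ∈ Finset.univ.filter (fun b : ZMod (p ^ (n + 1)) =>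
        ZMod.castHom (pow_dvd_pow p n.le_succ) (ZMod (p ^ n)) b = a),
        D.integral (fun x => cellInd (n + 1) b x * g x) = D.integral fun x => cellInd n a x * g x
    rw [← D.integral_finset_sum _ fun b _ => huc b]
    refine congr_arg D.integral (funext fun x => ?_)
    rw [← Finset.sum_mul, sum_cellInd_succ]
  bound := D.bound * C
  bound_nonneg := mul_nonneg D.bound_nonneg hC0
  norm_le n a := by
    refine D.norm_integral_le (uniformContinuous_mul' (uniformContinuous_cellInd _ _) hg) hC0 fun x => ?_
    rw [norm_mul]
    calc ‖cellInd (𝕜 := 𝕜) n a x‖ * ‖g x‖ ≤ 1 * C :=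
          mul_le_mul (norm_cellInd_le n a x) (hC x) (norm_nonneg _) zero_le_one
      _ = C := one_mul C

/-- The level data of `g · μ`. [folklore] -/
@[simp] theorem mulFn_μ (g : ℤ_[p] → 𝕜) (hg : UniformContinuous g) {C : ℝ} (hC0 : 0 ≤ C)
    (hC : ∀ x, ‖g x‖ ≤ C) (n : ℕ) (a : ZMod (p ^ n)) :
    (D.mulFn g hg hC0 hC).μ n a = D.integral fun x => cellInd n a x * g x := rfl

/-- The bound of `g · μ` is `‖μ‖ · C`. [folklore] -/
@[simp] theorem mulFn_bound (g : ℤ_[p] → 𝕜) (hg : UniformContinuous g) {C : ℝ} (hC0 : 0 ≤ C)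
    (hC : ∀ x, ‖g x‖ ≤ C) : (D.mulFn g hg hC0 hC).bound = D.bound * C := rfl

/-- **The Riemann sums of `g · μ` are integrals of step approximations**:
`RS(g·μ, f, n) = ∫ f(repr(x mod p^n)) g(x) dμ(x)`. [folklore] -/
theorem riemannSum_mulFn (g : ℤ_[p] → 𝕜) (hg : UniformContinuous g) {C : ℝ} (hC0 : 0 ≤ C)
    (hC : ∀ x, ‖g x‖ ≤ C) (f : ℤ_[p] → 𝕜) (n : ℕ) :
    (D.mulFn g hg hC0 hC).riemannSum f n =
      D.integral fun x => f ((PadicInt.toZModPow n x).val : ℤ_[p]) * g x := by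
  have huc : ∀ a : ZMod (p ^ n), UniformContinuous fun x => f (a.val : ℤ_[p]) * (cellInd (𝕜 := 𝕜) n a x * g x) :=
    fun a => uniformContinuous_mul' uniformContinuous_const
      (uniformContinuous_mul' (uniformContinuous_cellInd _ _) hg)
  rw [riemannSum_def]
  simp only [mulFn_μ, ProfiniteTower.padicInt_repr]
  calc ∑ a : ZMod (p ^ n), (D.integral fun x => cellInd n a x * g x) * f (a.val : ℤ_[p])
      = ∑ a : ZMod (p ^ n), D.integral fun x => f (a.val : ℤ_[p]) * (cellInd n a x * g x) := by
        refine Finset.sum_congr rfl fun a _ => ?_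
        rw [mul_comm, D.integral_const_mul _ (uniformContinuous_mul' (uniformContinuous_cellInd _ _) hg)]
    _ = D.integral fun x => ∑ a : ZMod (p ^ n), f (a.val : ℤ_[p]) * (cellInd n a x * g x) :=
        (D.integral_finset_sum _ fun a _ => huc a).symm
    _ = D.integral fun x => f ((PadicInt.toZModPow n x).val : ℤ_[p]) * g x := by
        refine congr_arg D.integral (funext fun x => ?_)
        simp_rw [← mul_assoc]
        rw [← Finset.sum_mul, sum_mul_cellInd n (fun a => f (a.val : ℤ_[p])) x]

/-- **Integration against a density**: `∫ f d(g·μ) = ∫ f g dμ` for `f` uniformly continuous.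
[folklore] -/
theorem integral_mulFn (g : ℤ_[p] → 𝕜) (hg : UniformContinuous g) {C : ℝ} (hC0 : 0 ≤ C)
    (hC : ∀ x, ‖g x‖ ≤ C) {f : ℤ_[p] → 𝕜} (hf : UniformContinuous f) :
    (D.mulFn g hg hC0 hC).integral f = D.integral fun x => f x * g x := by
  have hfg : UniformContinuous fun x => f x * g x := uniformContinuous_mul' hf hg
  have hstep : ∀ n : ℕ, UniformContinuous fun x : ℤ_[p] => f ((PadicInt.toZModPow n x).val : ℤ_[p]) * g x :=
    fun n => uniformContinuous_mul' (uniformContinuous_comp_toZModPow n fun a => f (a.val : ℤ_[p])) hg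
  -- the Riemann sums of `g·μ` are `∫ f_n g dμ` with `f_n → f` uniformly
  have h1 : Tendsto (fun n => D.integral fun x => f ((PadicInt.toZModPow n x).val : ℤ_[p]) * g x) atTop
      (𝓝 ((D.mulFn g hg hC0 hC).integral f)) :=
    ((D.mulFn g hg hC0 hC).tendsto_riemannSum_integral hf).congr fun n =>
      D.riemannSum_mulFn g hg hC0 hC f n
  have h2 : Tendsto (fun n => D.integral fun x => f ((PadicInt.toZModPow n x).val : ℤ_[p]) * g x) atTop
      (𝓝 (D.integral fun x => f x * g x)) := by
    refine Metric.tendsto_atTop.mpr fun ε hε => ?_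
    have hb : 0 < D.bound * C + 1 := by linarith [mul_nonneg D.bound_nonneg hC0]
    obtain ⟨N, hN⟩ := (ProfiniteTower.padicInt p).exists_forall_norm_sub_le hf (div_pos hε hb)
    refine ⟨N, fun n hn => ?_⟩
    rw [dist_eq_norm, ← D.integral_sub (hstep n) hfg]
    have hle : ∀ x : ℤ_[p], ‖f ((PadicInt.toZModPow n x).val : ℤ_[p]) * g x - f x * g x‖ ≤ ε / (D.bound * C + 1) * C := by
      intro x
      rw [← sub_mul, norm_mul]
      refine mul_le_mul (hN n hn _ _ ?_) (hC x) (norm_nonneg _) (div_pos hε hb).le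
      exact (ProfiniteTower.padicInt p).proj_repr n (PadicInt.toZModPow n x)
    calc ‖D.integral fun x => f ((PadicInt.toZModPow n x).val : ℤ_[p]) * g x - f x * g x‖
        ≤ D.bound * (ε / (D.bound * C + 1) * C) :=
          D.norm_integral_le ((hstep n).sub hfg) (mul_nonneg (div_pos hε hb).le hC0) hle
      _ = (D.bound * C) * (ε / (D.bound * C + 1)) := by ring
      _ < ε := by
          rw [mul_div_assoc', div_lt_iff₀ hb]
          nlinarith [mul_nonneg D.bound_nonneg hC0]
  exact tendsto_nhds_unique h1 h2

end BoundedDistribution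

/-! ### The Möbius maps of `Σ₀(p)` on `ℤ_p` and on the cells -/

section Moebius

/-- For `a ∈ ℤ_p^×` (`‖a‖ = 1`), `p ∣ c` (`‖c‖ < 1`) and `z ∈ ℤ_p`, the automorphy factor `a + c z` is a
unit. [folklore] -/
theorem norm_add_mul_eq_one {a c : ℤ_[p]} (ha : ‖a‖ = 1) (hc : ‖c‖ < 1) (z : ℤ_[p]) : ‖a + c * z‖ = 1 := by
  have hcz : ‖c * z‖ < 1 := by
    rw [norm_mul]
    calc ‖c‖ * ‖z‖ ≤ ‖c‖ * 1 := mul_le_mul_of_nonneg_left (PadicInt.norm_le_one z) (norm_nonneg _)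
      _ < 1 := by rw [mul_one]; exact hc
  have h : ‖c * z‖ < ‖a‖ := by rw [ha]; exact hcz
  rw [IsUltrametricDist.norm_add_eq_max_of_norm_ne_norm h.ne', max_eq_left h.le, ha]

/-- **The automorphy factor `a + c z` as a unit of `ℤ_p`.** [folklore] -/
def autFactor {a c : ℤ_[p]} (ha : ‖a‖ = 1) (hc : ‖c‖ < 1) (z : ℤ_[p]) : ℤ_[p]ˣ :=
  PadicInt.mkUnits (u := ((a + c * z : ℤ_[p]) : ℚ_[p]))
    (by rw [PadicInt.padic_norm_e_of_padicInt]; exact norm_add_mul_eq_one ha hc z)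

/-- The value of the automorphy factor. [folklore] -/
@[simp] theorem coe_autFactor {a c : ℤ_[p]} (ha : ‖a‖ = 1) (hc : ‖c‖ < 1) (z : ℤ_[p]) :
    ((autFactor ha hc z : ℤ_[p]ˣ) : ℤ_[p]) = a + c * z := rfl

/-- **The Möbius map `z ↦ γ·z = (b + d z)(a + c z)^{-1}` of `γ = (a b; c d) ∈ Σ₀(p)` on `ℤ_p`.**
[cite: Bellaiche2011, §3.1] -/
def moebius {a c : ℤ_[p]} (ha : ‖a‖ = 1) (hc : ‖c‖ < 1) (b d : ℤ_[p]) (z : ℤ_[p]) : ℤ_[p] :=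
  (b + d * z) * ((autFactor ha hc z)⁻¹ : ℤ_[p]ˣ)

/-- The defining identity `(a + c z) · (γ·z) = b + d z`. [folklore] -/
theorem autFactor_mul_moebius {a c : ℤ_[p]} (ha : ‖a‖ = 1) (hc : ‖c‖ < 1) (b d z : ℤ_[p]) :
    (a + c * z) * moebius ha hc b d z = b + d * z := by
  rw [moebius, ← coe_autFactor ha hc z, mul_left_comm, Units.mul_inv, mul_one]

/-- **The Möbius maps are `1`-Lipschitz**: `(a + cz)(a + cz')(γ·z − γ·z') = (ad − bc)(z − z')`, so
`‖γ·z − γ·z'‖ ≤ ‖z − z'‖`. [folklore] -/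
theorem norm_moebius_sub_moebius_le {a c : ℤ_[p]} (ha : ‖a‖ = 1) (hc : ‖c‖ < 1) (b d z z' : ℤ_[p]) :
    ‖moebius ha hc b d z - moebius ha hc b d z'‖ ≤ ‖z - z'‖ := by
  have key : (a + c * z) * (a + c * z') * (moebius ha hc b d z - moebius ha hc b d z') =
      (a * d - b * c) * (z - z') := by
    have h1 := autFactor_mul_moebius ha hc b d z
    have h2 := autFactor_mul_moebius ha hc b d z'
    calc (a + c * z) * (a + c * z') * (moebius ha hc b d z - moebius ha hc b d z')
        = (a + c * z') * ((a + c * z) * moebius ha hc b d z) -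
            (a + c * z) * ((a + c * z') * moebius ha hc b d z') := by ring
      _ = (a + c * z') * (b + d * z) - (a + c * z) * (b + d * z') := by rw [h1, h2]
      _ = (a * d - b * c) * (z - z') := by ring
  have hn := congr_arg (fun w : ℤ_[p] => ‖w‖) key
  simp only [norm_mul, norm_add_mul_eq_one ha hc, one_mul] at hn
  rw [hn]
  exact mul_le_of_le_one_left (norm_nonneg _) (PadicInt.norm_le_one _)

/-- `moebius` is uniformly continuous. [folklore] -/
theorem uniformContinuous_moebius {a c : ℤ_[p]} (ha : ‖a‖ = 1) (hc : ‖c‖ < 1) (b d : ℤ_[p]) :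
    UniformContinuous (moebius ha hc b d) :=
  Metric.uniformContinuous_iff.mpr fun ε hε => ⟨ε, hε, fun {z z'} h => by
    rw [dist_eq_norm] at h ⊢; exact (norm_moebius_sub_moebius_le ha hc b d z z').trans_lt h⟩

/-- **`γ·z mod p^n` depends only on `z mod p^n`.** [folklore] -/
theorem toZModPow_moebius_eq {a c : ℤ_[p]} (ha : ‖a‖ = 1) (hc : ‖c‖ < 1) (b d : ℤ_[p]) (n : ℕ)
    {z z' : ℤ_[p]} (h : PadicInt.toZModPow n z = PadicInt.toZModPow n z') :
    PadicInt.toZModPow n (moebius ha hc b d z) = PadicInt.toZModPow n (moebius ha hc b d z') := by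
  apply toZModPow_eq_of_norm_sub_le
  refine (norm_moebius_sub_moebius_le ha hc b d z z').trans ?_
  rw [PadicInt.norm_le_pow_iff_mem_span_pow, ← PadicInt.ker_toZModPow, RingHom.mem_ker, map_sub, h, sub_self]

variable (p) in
/-- **The Möbius map on the cells**: the level-compatible family `z mod p^n ↦ γ·z mod p^n` on the
tower `ℤ_p = lim ℤ/p^n`. [folklore] -/
def ProfiniteTower.moebiusCellMap {a c : ℤ_[p]} (ha : ‖a‖ = 1) (hc : ‖c‖ < 1) (b d : ℤ_[p]) :
    (ProfiniteTower.padicInt p).CellMap (ProfiniteTower.padicInt p) where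
  map n s := PadicInt.toZModPow n (moebius ha hc b d (s.val : ℤ_[p]))
  map_trans n s := by
    haveI : NeZero (p ^ (n + 1)) := ⟨pow_ne_zero _ (Fact.out : p.Prime).ne_zero⟩
    haveI : NeZero (p ^ n) := ⟨pow_ne_zero _ (Fact.out : p.Prime).ne_zero⟩
    simp only [ProfiniteTower.padicInt_trans]
    rw [ZMod.castHom_apply, ZMod.castHom_apply, PadicInt.cast_toZModPow _ _ n.le_succ]
    apply toZModPow_moebius_eq
    -- both representatives reduce to `s mod p^n`
    rw [map_natCast, map_natCast, ZMod.natCast_zmod_val, ZMod.cast_eq_val]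

/-- The level maps of `moebiusCellMap`. [folklore] -/
theorem ProfiniteTower.moebiusCellMap_map {a c : ℤ_[p]} (ha : ‖a‖ = 1) (hc : ‖c‖ < 1) (b d : ℤ_[p])
    (n : ℕ) (s : ZMod (p ^ n)) :
    (ProfiniteTower.moebiusCellMap p ha hc b d).map n s =
      PadicInt.toZModPow n (moebius ha hc b d (s.val : ℤ_[p])) := rfl

/-- **`moebius` lies over `moebiusCellMap`.** [folklore] -/
theorem proj_moebius {a c : ℤ_[p]} (ha : ‖a‖ = 1) (hc : ‖c‖ < 1) (b d : ℤ_[p]) (n : ℕ) (z : ℤ_[p]) :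
    (ProfiniteTower.padicInt p).proj n (moebius ha hc b d z) =
      (ProfiniteTower.moebiusCellMap p ha hc b d).map n ((ProfiniteTower.padicInt p).proj n z) := by
  haveI : NeZero (p ^ n) := ⟨pow_ne_zero _ (Fact.out : p.Prime).ne_zero⟩
  rw [ProfiniteTower.padicInt_proj, ProfiniteTower.padicInt_proj, ProfiniteTower.moebiusCellMap_map]
  apply toZModPow_moebius_eq
  rw [map_natCast, ZMod.natCast_zmod_val]

end Moebius

/-! ### The weight-`k` action -/

namespace BoundedDistribution

variable {𝕜 : Type*} [NormedField 𝕜] [NormedAlgebra ℚ_[p] 𝕜]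

/-- The automorphy factor `(a + c z)^k` as a `𝕜`-valued function. [folklore] -/
def autPow (k : ℕ) (a c : ℤ_[p]) (z : ℤ_[p]) : 𝕜 := algebraMap ℚ_[p] 𝕜 (((a + c * z) ^ k : ℤ_[p]) : ℚ_[p])

/-- Unfolding lemma for `autPow`. [folklore] -/
theorem autPow_apply (k : ℕ) (a c z : ℤ_[p]) :
    autPow (𝕜 := 𝕜) k a c z = algebraMap ℚ_[p] 𝕜 (((a + c * z) ^ k : ℤ_[p]) : ℚ_[p]) := rfl

/-- `autPow` is uniformly continuous. [folklore] -/
theorem uniformContinuous_autPow (k : ℕ) (a c : ℤ_[p]) : UniformContinuous (autPow (𝕜 := 𝕜) k a c) :=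
  CompactSpace.uniformContinuous_of_continuous (by unfold autPow; fun_prop)

/-- `‖(a + c z)^k‖ ≤ 1`. [folklore] -/
theorem norm_autPow_le (k : ℕ) (a c z : ℤ_[p]) : ‖autPow (𝕜 := 𝕜) k a c z‖ ≤ 1 := by
  rw [autPow_apply, norm_algebraMap', PadicInt.padic_norm_e_of_padicInt]
  exact PadicInt.norm_le_one _

variable [IsUltrametricDist 𝕜] [CompleteSpace 𝕜] (D : BoundedDistribution (ProfiniteTower.padicInt p) 𝕜)

/-- **The weight-`k` action `μ |_k γ` of `γ = (a b; c d) ∈ Σ₀(p)`** on bounded distributions on `ℤ_p`: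
the push-forward along `z ↦ γ·z` of the density `(a + c z)^k · μ` (Bellaïche 2011, §3.1: the dual
of `f ↦ (a + cz)^k f((b + dz)/(a + cz))`). [cite: Bellaiche2011, §3.1] -/
def weightAct (k : ℕ) {a c : ℤ_[p]} (ha : ‖a‖ = 1) (hc : ‖c‖ < 1) (b d : ℤ_[p]) :
    BoundedDistribution (ProfiniteTower.padicInt p) 𝕜 :=
  (D.mulFn (autPow k a c) (uniformContinuous_autPow k a c) zero_le_one (norm_autPow_le k a c)).map
    (ProfiniteTower.moebiusCellMap p ha hc b d)

/-- The bound of `μ |_k γ` is that of `μ`. [folklore] -/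
@[simp] theorem weightAct_bound (k : ℕ) {a c : ℤ_[p]} (ha : ‖a‖ = 1) (hc : ‖c‖ < 1) (b d : ℤ_[p]) :
    (D.weightAct k ha hc b d).bound = D.bound := by
  rw [weightAct, map_bound, mulFn_bound, mul_one]

/-- **Integration formula for the weight-`k` action**:
`∫ f d(μ |_k γ) = ∫ (a + c z)^k f(γ·z) dμ(z)` for `f` uniformly continuous. [cite: Bellaiche2011, §3.1] -/
theorem integral_weightAct (k : ℕ) {a c : ℤ_[p]} (ha : ‖a‖ = 1) (hc : ‖c‖ < 1) (b d : ℤ_[p])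
    {f : ℤ_[p] → 𝕜} (hf : UniformContinuous f) :
    (D.weightAct k ha hc b d).integral f = D.integral fun z => f (moebius ha hc b d z) * autPow k a c z := by
  rw [weightAct, integral_map _ _ (proj_moebius ha hc b d) hf (hf.comp (uniformContinuous_moebius ha hc b d)),
    integral_mulFn _ _ _ _ _ (hf.comp (uniformContinuous_moebius ha hc b d))]
  rfl

end BoundedDistribution

end Literature.NumberTheory.EllipticCurves

end
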